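import Literature.NumberTheory.EllipticCurves.SwanConductorTorsionProofs
import Literature.NumberTheory.EllipticCurves.QuadraticTwistTateFormProofs
import Literature.NumberTheory.EllipticCurves.HasseWeilAbelianPotentialGoodReductionProofs
import Literature.NumberTheory.EllipticCurves.InertiaFixedTorsionOfTamagawaProofs
import Literature.NumberTheory.EllipticCurves.SelmerInertiaProofs
import Literature.NumberTheory.EllipticCurves.NeronOggShafarevichLocal
import Literature.NumberTheory.EllipticCurves.TateModuleContinuityProofs
import Literature.NumberTheory.GaloisRepresentations.ArtinConductorProofs
import Literature.NumberTheory.GaloisRepresentations.IntegralGaloisActionProofs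
import Literature.NumberTheory.DiophantineGeometry.ConductorTameProofs
import Literature.NumberTheory.DiophantineGeometry.TateAlgorithmAdditiveProofs
import HarnessLib

/-!
# The Serre conductor exponent of the `p`-torsion `E[p]` at an additive place `v ∤ 6p`:
# `a_v(E[p]) = 2 = f_v(E)` for `p ≥ 5`, and the CONDUCTOR DROP `a_v(E[3]) = 1` when `3 ∣ c_v`
# (theorems only)

`Proofs` file (theorems only: no definition, no named fact, no instance), topic
`NumberTheory/EllipticCurves`.  For an elliptic curve `E/K` over a number field and its `n`-torsion
`E[n] = E(K̄)[n]` as the continuous `ℤ/n`-linear Galois representation `W.torsionGaloisRep n` (item G09,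
`SwanConductorTorsionProofs`), the tree's Artin-conductor API (`GaloisRep.artinConductorAt`,
`GaloisRep.artinConductorExponent`, `ArtinConductor.lean`; these are the exponents of Serre's level
`ModPGaloisRep.serreLevel`, Serre 1987 §1.2) gives `a_𝔓(E[p]) = codim E[p]^{I_𝔓} + Sw_𝔓(E[p])`.
This file computes it at the ADDITIVE places `v ∤ 6p`:

* §1 `WeierstrassCurve.isTameAt_torsionGaloisRep_of_notMem_two_three` — **`E[ℓ]` is tame at every
  place `v ∤ 6ℓ`** (so `Sw_𝔓(E[ℓ]) = 0`): at integral `j` the wild ramification groups fix the prime-to-`v`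
  torsion (`smul_torsion_eq_self_of_mem_absUpperRamificationSubgroup_of_valuation_j_le_one`, good
  reduction over `K(Δ^{1/12})`, Silverman *ATAEC* IV.10.2(b)); at `ord_v(j) < 0` the `ℓ`-adic
  representation is tame (`isTameAt_rationalTate_of_one_lt_valuation_j`, Tate curve) and `V_ℓ E` is tame
  iff `E[ℓ]` is (`isTameAt_rationalTate_iff_torsion`).
* §2 `WeierstrassCurve.mem_fixedSubmodule_inertia_primeBelow_iff` — the GLOBAL inertia invariants
  `E[n]^{I_𝔓}` at the prime `𝔓 = 𝔓_{ι₀,𝔐}` of `\bar ℤ_K` cut out by the chosen embedding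
  `ι₀ : K̄ → K̄_v` are the points fixed by the LOCAL inertia group `I_𝔐 ≤ Γ_{K_v}` (Neukirch II (9.6):
  `resGalOfEmb_mem_inertia_primeBelow` and the surjection `exists_mem_inertia_apply_eq_holds`).
* §3 (`p = 3`, `3 ∣ c_v`) `WeierstrassCurve.natCard_fixedSubmodule_inertia_primeBelow_torsion_three`,
  `…codimFixed_inertia_torsion_three_eq_one`: from the sibling file
  `InertiaFixedTorsionOfTamagawaProofs` ("`E[3]^{I_v}` is EXACTLY a line" at an additive `v ∤ 3` with
  `3 ∣ c_v`, i.e. Kodaira `IV`/`IV*` with `c_v = 3`) — **`codim E[3]^{I_𝔓} = 1` at every `𝔓 ∣ v`**.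
* §4 `WeierstrassCurve.artinConductorAt_torsion_three_eq_one_of_isTameAt`,
  `…artinConductorExponent_torsion_three_eq_one` — **`a_v(E[3]) = 1`** at an additive `v ∤ 6` with
  `3 ∣ c_v` (unconditional; at `v ∣ 2` modulo tameness of `E[3]` at `v`).  Since `f_v(E) = 2` there
  (`conductorExponent_eq_tameConductorExponent_holds`), this is the CONDUCTOR DROP `q² ∥ N_E` but
  `q ∥ N(ρ̄_{E,3})` (Carayol 1989 / Livné: the Serre level of `ρ̄` loses one factor `q` at such primes).
* §5 (`p ≥ 5`) `WeierstrassCurve.eq_bot_of_absInertia_fixed_of_hasAdditiveReductionAt_of_five_le`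
  (an inertia-fixed subgroup of `E[p]` at an additive `v ∤ p` is TRIVIAL for `p ≥ 5`: it has `≤ 4` points
  by `InertiaFixedTorsionAdditiveIndexBoundProofs` and order dividing `p²`),
  `…codimFixed_inertia_torsion_eq_two_of_five_le`, `…artinConductorExponent_torsion_eq_two_of_five_le`,
  **`…artinConductorExponent_torsion_eq_conductorExponent_of_five_le`: `a_v(E[p]) = 2 = f_v(E)` at every
  additive `v ∤ 6p`** — the Serre conductor of `ρ̄_{E,p}` keeps the full additive conductor for `p ≥ 5`
  (no conductor drop, so no level-lowering to a semistable level at such `p`).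

Consumer (cell `bsd-ssimc`, crux `KobayashiLowerHalfLargeImage`, item stmt-BirchSwinnertonDyer-19001):
§4 is the level clause "`q ∥ N(ρ̄)`" of line `shadow_seed` (`p = 3`: at a shadow prime `q` — Kodaira
`IV`/`IV*`, `c_q = 3`, `q ≥ 5` — Diamond's level-lowered newform `g` of level `M ∣ N(ρ̄_{E,3})` has
`q ∥ M`, i.e. is Steinberg at `q`, which puts `g` on the Fouquet–Wan locus); §5 is the reason recorded in
the cell's dossier why mod-`p` level transport to square-free level is impossible at `p ≥ 5`
("`cond ρ̄_{E,p} = cond E` at the additive primes").  Nothing is asserted about any particular curve;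
no modular form enters; BSD is not proved by any of this.

## References

* [SerreLocalFields1979] J.-P. Serre, *Local Fields*, GTM 67 (1979), Ch. VI §§1–3 (Artin and Swan
  conductors, globalisation).
* [Serre1987] J.-P. Serre, *Sur les représentations modulaires de degré 2 de Gal(ℚ̄/ℚ)*, Duke Math.
  J. 54 (1987), §1.2 (the level `N(ρ)`), §4.
* [SilvermanATAEC1994] J. H. Silverman, *Advanced Topics in the Arithmetic of Elliptic Curves*,
  GTM 151 (1994), §IV.10 (conductor, Thm. IV.10.2), Cor. IV.9.2(d) and Table 4.1.
* [SilvermanAEC2009] J. H. Silverman, *The Arithmetic of Elliptic Curves*, 2nd ed. (2009),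
  Thm. VII.6.1, Cor. III.6.4.
* [Carayol1989] H. Carayol, *Sur les représentations galoisiennes modulo ℓ attachées aux formes
  modulaires*, Duke Math. J. 59 (1989), 785–801.
* [NeukirchANT1999] J. Neukirch, *Algebraic Number Theory* (1999), Ch. II §9 Prop. (9.6).

## Design

No definitions; `noncomputable section`; one universe `u`; dot-notation extensions of Mathlib's
`WeierstrassCurve` namespace as in the sibling files.  The ONE local instance
`attribute [local instance] AddSubgroup.torsionBy.zmodModule` is Mathlib's own `ZMod n`-module structure
on `A[n]`, exactly as in `SwanConductorTorsionProofs` (where `torsionGaloisRep` is defined with it) and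
`ThreeTorsionCyclicInertiaSwanProofs`: it is the structure carried by the TYPE of `torsionGaloisRep`, so
every statement below needs it to elaborate; it overrides no library instance (there is no global
`Module (ZMod n) A[n]` instance) and introduces no new one.
Axioms: `propext`, `Classical.choice`, `Quot.sound`.
-/

noncomputable section

open scoped Classical NumberField Pointwise
open Field IsDedekindDomain IsDedekindDomain.HeightOneSpectrum NumberField

attribute [local instance] AddSubgroup.torsionBy.zmodModule

universe u

namespace WeierstrassCurve

open Literature.NumberTheory.EllipticCurves Literature.NumberTheory.GaloisRepresentations
  Literature.NumberTheory.DiophantineGeometry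

variable {K : Type u} [Field K] [NumberField K] (W : WeierstrassCurve K)

/-! ## §1. `E[ℓ]` is tame at every place `v ∤ 6ℓ` -/

omit [NumberField K] in
/-- If `σ ∈ Γ_K` fixes every `P ∈ E(K̄)` with `n P = O`, then `ρ̄_{E,n}(σ) = 1` on `E[n]`
(`torsionGaloisRep`); private plumbing for §1. [folklore] -/
private theorem torsionGaloisRep_eq_one_of_forall_smul_eq {n : ℕ} {σ : absoluteGaloisGroup K}
    (h : ∀ P : geomPoints W, n • P = 0 → σ • P = P) : W.torsionGaloisRep n σ = 1 := by
  refine LinearMap.ext fun P ↦ Subtype.ext ?_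
  have hP : n • (P : geomPoints W) = 0 := by
    have h' := (mem_geomTorsion_iff W (n : ℤ) (P : geomPoints W)).mp P.2
    rwa [natCast_zsmul] at h'
  exact h P hP

/-- **`E[n]` is tame at a place `v ∤ 6n` of integral `j`** (Silverman *ATAEC* Thm. IV.10.2(b), clause
`p ≥ 5`, case `v(j) ≥ 0`, in Galois form for the `n`-torsion): for `2, 3, n ∉ v`, `ord_v(j(E)) ≥ 0`
and `𝔓 ∣ v`, every wild ramification group `Γ_K^u(𝔓)`, `u > 0`, acts trivially on `E[n]`, since it
fixes the prime-to-`v` torsion of `E(K̄)`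
(`smul_torsion_eq_self_of_mem_absUpperRamificationSubgroup_of_valuation_j_le_one`: good reduction over
`K(Δ^{1/12})`, *AEC* VII.5.5 with VII.4.1).
[cite: SilvermanATAEC1994, Thm. IV.10.2(b), clause p ≥ 5, case v(j) ≥ 0 (PDF pp. 358–362)] -/
theorem isTameAt_torsionGaloisRep_of_valuation_j_le_one [W.IsElliptic]
    {v : HeightOneSpectrum (𝓞 K)} {n : ℕ} (hn : (n : 𝓞 K) ∉ v.asIdeal)
    (hj : v.valuation K W.j ≤ 1) (h2 : (2 : 𝓞 K) ∉ v.asIdeal) (h3 : (3 : 𝓞 K) ∉ v.asIdeal)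
    {𝔓 : Ideal (absIntegers (𝓞 K) K)} (h𝔓 : 𝔓 ∈ v.primesAbove) :
    (W.torsionGaloisRep n).IsTameAt (𝓞 K) 𝔓 :=
  fun _ hu _ hσ ↦ W.torsionGaloisRep_eq_one_of_forall_smul_eq fun P hP ↦
    W.smul_torsion_eq_self_of_mem_absUpperRamificationSubgroup_of_valuation_j_le_one hj h2 h3 h𝔓 hu
      hσ hn P hP

/-- **`E[ℓ]` is tame at a place `v ∤ 2ℓ` with `ord_v(j) < 0`** (potentially multiplicative
reduction; Silverman *ATAEC* Thm. IV.10.2(b), proof, case `v(j) < 0`): `V_ℓ E` is tame there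
(`isTameAt_rationalTate_of_one_lt_valuation_j`, a quadratic twist is a Tate curve) and `V_ℓ E` is
tame at `𝔓 ∣ v ∤ ℓ` iff `E[ℓ]` is (`isTameAt_rationalTate_iff_torsion`).
[cite: SilvermanATAEC1994, Thm. IV.10.2(b) and its proof, case v(j) < 0 (PDF pp. 358–362)] -/
theorem isTameAt_torsionGaloisRep_of_one_lt_valuation_j [W.IsElliptic] (ℓ : ℕ) [Fact ℓ.Prime]
    {v : HeightOneSpectrum (𝓞 K)} (hℓ : (ℓ : 𝓞 K) ∉ v.asIdeal)
    (h2 : ringChar (𝓞 K ⧸ v.asIdeal) ≠ 2) (hj : 1 < v.valuation K W.j)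
    {𝔓 : Ideal (absIntegers (𝓞 K) K)} (h𝔓 : 𝔓 ∈ v.primesAbove) :
    (W.torsionGaloisRep ℓ).IsTameAt (𝓞 K) 𝔓 :=
  have h := W.continuous_rationalGaloisRepTate_holds ℓ
  (W.isTameAt_rationalTate_iff_torsion ℓ h hℓ h𝔓).mp
    (W.isTameAt_rationalTate_of_one_lt_valuation_j ℓ h hℓ h2 hj h𝔓)

/-- **`E[ℓ]` is tame at every place `v ∤ 6ℓ`** (`2, 3, ℓ ∉ v`, any prime `𝔓 ∣ v` of `\bar ℤ_K`):
the wild ramification groups `Γ_K^u(𝔓)`, `u > 0`, act trivially on `E[ℓ]` — case `ord_v(j) ≥ 0` by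
`isTameAt_torsionGaloisRep_of_valuation_j_le_one`, case `ord_v(j) < 0` by
`isTameAt_torsionGaloisRep_of_one_lt_valuation_j`.  In Silverman's terms: `L = K(E[ℓ])` is at worst
tamely ramified at the places of residue characteristic `≥ 5`, `≠ ℓ`.
[cite: SilvermanATAEC1994, Thm. IV.10.2(b), clause p ≥ 5, and its proof (PDF pp. 358–362)] -/
theorem isTameAt_torsionGaloisRep_of_notMem_two_three [W.IsElliptic] (ℓ : ℕ) [Fact ℓ.Prime]
    {v : HeightOneSpectrum (𝓞 K)} (hℓ : (ℓ : 𝓞 K) ∉ v.asIdeal)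
    (h2 : (2 : 𝓞 K) ∉ v.asIdeal) (h3 : (3 : 𝓞 K) ∉ v.asIdeal)
    {𝔓 : Ideal (absIntegers (𝓞 K) K)} (h𝔓 : 𝔓 ∈ v.primesAbove) :
    (W.torsionGaloisRep ℓ).IsTameAt (𝓞 K) 𝔓 := by
  by_cases hj : v.valuation K W.j ≤ 1
  · exact W.isTameAt_torsionGaloisRep_of_valuation_j_le_one hℓ hj h2 h3 h𝔓
  · exact W.isTameAt_torsionGaloisRep_of_one_lt_valuation_j ℓ hℓ
      (v.ringChar_ne_of_natCast_notMem (p := 2) (by exact_mod_cast h2)) (not_le.mp hj) h𝔓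

/-- **`Sw_𝔓(E[ℓ]) = 0` at every place `v ∤ 6ℓ`** (the wild conductor of the `ℓ`-torsion vanishes
away from `2, 3, ℓ`; Silverman's `δ(E/K) = 0` for `p ≥ 5`), from
`isTameAt_torsionGaloisRep_of_notMem_two_three` and `GaloisRep.IsTameAt.swanConductorAt_eq_zero`.
[cite: SilvermanATAEC1994, Thm. IV.10.2(b), clause p ≥ 5 (PDF pp. 358–362)] -/
theorem swanConductorAt_torsionGaloisRep_eq_zero_of_notMem_two_three [W.IsElliptic] (ℓ : ℕ)
    [Fact ℓ.Prime] {v : HeightOneSpectrum (𝓞 K)} (hℓ : (ℓ : 𝓞 K) ∉ v.asIdeal)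
    (h2 : (2 : 𝓞 K) ∉ v.asIdeal) (h3 : (3 : 𝓞 K) ∉ v.asIdeal)
    {𝔓 : Ideal (absIntegers (𝓞 K) K)} (h𝔓 : 𝔓 ∈ v.primesAbove) :
    (W.torsionGaloisRep ℓ).swanConductorAt (𝓞 K) 𝔓 = 0 :=
  (W.isTameAt_torsionGaloisRep_of_notMem_two_three ℓ hℓ h2 h3 h𝔓).swanConductorAt_eq_zero

/-! ## §2. Global inertia invariants at `𝔓_{ι₀,𝔐}` are the points fixed by the local inertia group -/

/-- **`E[n]^{I_𝔓}` at the prime cut out by the chosen embedding.**  Let `v` be a finite place of the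
number field `K`, `𝔐` a prime of `\bar 𝓞_v` above `𝓂_v`, `ι₀ = closureEmb : K̄ → K̄_v` the chosen
`K`-embedding and `𝔓 = 𝔓_{ι₀,𝔐}` (`v.primeBelow ι₀ 𝔐`) the prime of `\bar ℤ_K` it cuts out.  A point
`P ∈ E[n]` is fixed by the GLOBAL inertia group `I_𝔓 ≤ Γ_K` (i.e. lies in
`(W.torsionGaloisRep n).fixedSubmodule I_𝔓`) iff it is fixed by the LOCAL inertia group
`I_𝔐 ≤ Γ_{K_v}` acting through the restriction `Γ_{K_v} → Γ_K` (`absGaloisRestrict`): restriction maps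
`I_𝔐` into `I_𝔓` (`resGalOfEmb_mem_inertia_primeBelow`) and ONTO it
(`exists_mem_inertia_apply_eq_holds`, Neukirch II (9.6)).
[cite: NeukirchANT1999, Ch. II §9 Prop. (9.6)] -/
theorem mem_fixedSubmodule_inertia_primeBelow_iff {v : HeightOneSpectrum (𝓞 K)} {n : ℕ}
    {𝔐 : Ideal (localAbsIntegers v)} (h𝔐 : 𝔐 ∈ v.localPrimesAbove)
    (P : geomTorsion W (n : ℤ)) :
    P ∈ (W.torsionGaloisRep n).fixedSubmodule
        ((v.primeBelow (closureEmb (K := K) (v.adicCompletion K)) 𝔐).inertia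
          (absoluteGaloisGroup K)) ↔
      ∀ σ ∈ 𝔐.inertia (absoluteGaloisGroup (v.adicCompletion K)),
        absGaloisRestrict K (v.adicCompletion K) σ • (P : geomPoints W) = P := by
  rw [mem_fixedSubmodule_torsionGaloisRep_iff]
  constructor
  · intro h σ hσ
    exact h _ (v.resGalOfEmb_mem_inertia_primeBelow (closureEmb (K := K) (v.adicCompletion K)) 𝔐 hσ)
  · intro h τ hτ
    obtain ⟨σ, hσI, hσ⟩ :=
      v.exists_mem_inertia_apply_eq_holds (closureEmb (K := K) (v.adicCompletion K)) h𝔐 hτ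
    have hres : resGalOfEmb (closureEmb (K := K) (v.adicCompletion K)) σ = τ :=
      resGalOfEmb_eq_of_apply_eq _ hσ
    rw [← hres]
    exact h σ hσI

/-! ## §3. `p = 3`, `3 ∣ c_v`: `codim E[3]^{I_𝔓} = 1` -/

section Three

variable {v : HeightOneSpectrum (𝓞 K)}

/-- **`#E[3]^{I_𝔓} = 3` at an additive `v ∤ 3` with `3 ∣ c_v`** (for the prime `𝔓 = 𝔓_{ι₀,𝔐}` cut
out by the chosen embedding `K̄ → K̄_v`): the global inertia invariants of `E[3]` at `𝔓` are the line of
`exists_line_geomTorsion_three_absInertia_fixed_of_dvd_localTamagawaNumber` (an inertia-fixed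
`3`-torsion point off `E₀` exists because `3 ∣ c_v = [E(K_v) : E₀(K_v)]`, and at most a line is fixed
at an additive place), read through `mem_fixedSubmodule_inertia_primeBelow_iff` and
`I_𝔐 = absInertia K_v` (`inertia_eq_absInertia`).
[cite: SilvermanAEC2009, Thm. VII.6.1 (PDF p. 177) and proof of Thm. VII.7.1 (PDF p. 179)]
[cite: SilvermanATAEC1994, Cor. IV.9.2(d) with Table 4.1 (PDF pp. 340, 365)] -/
theorem natCard_fixedSubmodule_inertia_primeBelow_torsion_three [W.IsElliptic]
    (hadd : W.HasAdditiveReductionAt v) (h3v : (3 : 𝓞 K) ∉ v.asIdeal)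
    (hdvd : 3 ∣ (W.baseChange (v.adicCompletion K)).localTamagawaNumber
      (v.adicCompletionIntegers K))
    {𝔐 : Ideal (localAbsIntegers v)} (h𝔐 : 𝔐 ∈ v.localPrimesAbove) :
    Nat.card ((W.torsionGaloisRep 3).fixedSubmodule
        ((v.primeBelow (closureEmb (K := K) (v.adicCompletion K)) 𝔐).inertia
          (absoluteGaloisGroup K))) = 3 := by
  obtain ⟨w, hw⟩ := v.exists_spectralValuation
  obtain ⟨A, hA3, hAcard, hAI, hAmax⟩ :=
    W.exists_line_geomTorsion_three_absInertia_fixed_of_dvd_localTamagawaNumber hadd h3v hdvd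
  have hIeq : 𝔐.inertia (absoluteGaloisGroup (v.adicCompletion K)) =
      absInertia (v.adicCompletion K) := inertia_eq_absInertia hw h𝔐
  set F := (W.torsionGaloisRep 3).fixedSubmodule
    ((v.primeBelow (closureEmb (K := K) (v.adicCompletion K)) 𝔐).inertia (absoluteGaloisGroup K))
    with hFdef
  have key : ∀ P : geomTorsion W ((3 : ℕ) : ℤ), P ∈ F ↔ (P : geomPoints W) ∈ A := by
    intro P
    rw [hFdef, W.mem_fixedSubmodule_inertia_primeBelow_iff h𝔐, hIeq]
    exact ⟨fun h ↦ hAmax _ P.2 h, fun hP σ hσ ↦ hAI σ hσ _ hP⟩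
  have e : F ≃ A :=
    { toFun := fun P ↦ ⟨(P.1 : geomPoints W), (key P.1).mp P.2⟩
      invFun := fun a ↦ ⟨⟨(a : geomPoints W), hA3 a.2⟩, (key _).mpr a.2⟩
      left_inv := fun P ↦ rfl
      right_inv := fun a ↦ rfl }
  rw [Nat.card_congr e, hAcard]

/-- **`dim_{𝔽₃} E[3]^{I_𝔓} = 1`** at an additive `v ∤ 3` with `3 ∣ c_v`, for `𝔓 = 𝔓_{ι₀,𝔐}`
(`#E[3]^{I_𝔓} = 3 = 3¹`, `natCard_fixedSubmodule_inertia_primeBelow_torsion_three`).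
[cite: SilvermanAEC2009, Thm. VII.6.1 (PDF p. 177)]
[cite: SilvermanATAEC1994, Cor. IV.9.2(d) with Table 4.1 (PDF pp. 340, 365)] -/
theorem finrank_fixedSubmodule_inertia_primeBelow_torsion_three [W.IsElliptic]
    (hadd : W.HasAdditiveReductionAt v) (h3v : (3 : 𝓞 K) ∉ v.asIdeal)
    (hdvd : 3 ∣ (W.baseChange (v.adicCompletion K)).localTamagawaNumber
      (v.adicCompletionIntegers K))
    {𝔐 : Ideal (localAbsIntegers v)} (h𝔐 : 𝔐 ∈ v.localPrimesAbove) :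
    Module.finrank (ZMod 3) ((W.torsionGaloisRep 3).fixedSubmodule
        ((v.primeBelow (closureEmb (K := K) (v.adicCompletion K)) 𝔐).inertia
          (absoluteGaloisGroup K))) = 1 := by
  haveI : Fact (Nat.Prime 3) := ⟨Nat.prime_three⟩
  set F := (W.torsionGaloisRep 3).fixedSubmodule
    ((v.primeBelow (closureEmb (K := K) (v.adicCompletion K)) 𝔐).inertia (absoluteGaloisGroup K))
    with hFdef
  have hcard : Nat.card F = 3 :=
    W.natCard_fixedSubmodule_inertia_primeBelow_torsion_three hadd h3v hdvd h𝔐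
  haveI : Finite F := Nat.finite_of_card_ne_zero (by rw [hcard]; norm_num)
  haveI : Module.Finite (ZMod 3) F := Module.Finite.of_finite
  have h := Module.natCard_eq_pow_finrank (K := ZMod 3) (V := F)
  rw [hcard, Nat.card_zmod] at h
  have h1 : (3 : ℕ) ^ 1 = 3 ^ Module.finrank (ZMod 3) F := by rw [pow_one]; exact h
  exact (Nat.pow_right_injective (a := 3) (by norm_num) h1).symm

/-- **`codim E[3]^{I_𝔓} = 1` at EVERY prime `𝔓 ∣ v`** for an additive `v ∤ 3` with `3 ∣ c_v`:
`dim E[3] = 2` (`finrank_geomTorsion_eq_two`), `dim E[3]^{I_𝔓} = 1` at `𝔓_{ι₀,𝔐}`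
(`finrank_fixedSubmodule_inertia_primeBelow_torsion_three`), and the codimension is the same at the
conjugate primes `g • 𝔓` (`Γ_K` is transitive on the primes above `v`,
`exists_smul_eq_of_mem_primesAbove_holds`; `I_{g𝔓} = g I_𝔓 g⁻¹`, `Ideal.inertia_smul`;
`ContinuousRep.codimFixed_conj_smul`).
[cite: SerreLocalFields1979, Ch. VI §2 Cor. 1' and §3 (globalisation)]
[cite: SilvermanAEC2009, Thm. VII.6.1 (PDF p. 177)] -/
theorem codimFixed_inertia_torsion_three_eq_one [W.IsElliptic]
    (hadd : W.HasAdditiveReductionAt v) (h3v : (3 : 𝓞 K) ∉ v.asIdeal)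
    (hdvd : 3 ∣ (W.baseChange (v.adicCompletion K)).localTamagawaNumber
      (v.adicCompletionIntegers K))
    {𝔓 : Ideal (absIntegers (𝓞 K) K)} (h𝔓 : 𝔓 ∈ v.primesAbove) :
    (W.torsionGaloisRep 3).codimFixed (𝔓.inertia (absoluteGaloisGroup K)) = 1 := by
  haveI : Fact (Nat.Prime 3) := ⟨Nat.prime_three⟩
  obtain ⟨𝔐, h𝔐⟩ := v.localPrimesAbove_nonempty
  have h𝔓₁ : v.primeBelow (closureEmb (K := K) (v.adicCompletion K)) 𝔐 ∈ v.primesAbove :=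
    primeBelow_mem_primesAbove h𝔐
  obtain ⟨g, hg⟩ := HeightOneSpectrum.exists_smul_eq_of_mem_primesAbove_holds h𝔓₁ h𝔓
  rw [← hg, Ideal.inertia_smul, ContinuousRep.codimFixed_conj_smul]
  haveI : Finite (geomTorsion W ((3 : ℕ) : ℤ)) := W.finite_geomTorsion_nat (by norm_num)
  haveI : Module.Finite (ZMod 3) (geomTorsion W ((3 : ℕ) : ℤ)) := Module.Finite.of_finite
  have h2 : Module.finrank (ZMod 3) (geomTorsion W ((3 : ℕ) : ℤ)) = 2 :=
    W.finrank_geomTorsion_eq_two 3 (by norm_num)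
  have h1 := W.finrank_fixedSubmodule_inertia_primeBelow_torsion_three hadd h3v hdvd h𝔐
  have h := ContinuousRep.codimFixed_eq_finrank_sub (W.torsionGaloisRep 3)
    ((v.primeBelow (closureEmb (K := K) (v.adicCompletion K)) 𝔐).inertia (absoluteGaloisGroup K))
  rw [h2] at h
  rw [h]
  change 2 - Module.finrank (ZMod 3) ((W.torsionGaloisRep 3).fixedSubmodule _) = 1
  rw [h1]

/-! ## §4. The conductor drop: `a_v(E[3]) = 1` -/

/-- **`a_𝔓(E[3]) = 1` at an additive `v ∤ 3` with `3 ∣ c_v`, granted tameness of `E[3]` at `𝔓`.**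
The Artin conductor `a_𝔓 = codim E[3]^{I_𝔓} + Sw_𝔓` (`GaloisRep.artinConductorAt`) of the `3`-torsion
at any `𝔓 ∣ v` is `1 + 0` (`codimFixed_inertia_torsion_three_eq_one`,
`GaloisRep.IsTameAt.swanConductorAt_eq_zero`).  Tameness is automatic at `v ∤ 2`
(`isTameAt_torsionGaloisRep_of_notMem_two_three`); at `v ∣ 2` it is the clause `f_2 = 2` of a shadow
prime.
[cite: SerreLocalFields1979, Ch. VI §2, Cor. 1'] [cite: Serre1987, §1.2 (definition of N(ρ))] -/
theorem artinConductorAt_torsion_three_eq_one_of_isTameAt [W.IsElliptic]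
    (hadd : W.HasAdditiveReductionAt v) (h3v : (3 : 𝓞 K) ∉ v.asIdeal)
    (hdvd : 3 ∣ (W.baseChange (v.adicCompletion K)).localTamagawaNumber
      (v.adicCompletionIntegers K))
    {𝔓 : Ideal (absIntegers (𝓞 K) K)} (h𝔓 : 𝔓 ∈ v.primesAbove)
    (htame : (W.torsionGaloisRep 3).IsTameAt (𝓞 K) 𝔓) :
    (W.torsionGaloisRep 3).artinConductorAt (𝓞 K) 𝔓 = 1 := by
  haveI : Fact (Nat.Prime 3) := ⟨Nat.prime_three⟩
  rw [GaloisRep.artinConductorAt_def, htame.swanConductorAt_eq_zero, add_zero]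
  change (((W.torsionGaloisRep 3).codimFixed (𝔓.inertia (absoluteGaloisGroup K)) : ℕ) : ℝ) = 1
  rw [W.codimFixed_inertia_torsion_three_eq_one hadd h3v hdvd h𝔓, Nat.cast_one]

/-- **The Serre conductor exponent `a_v(E[3]) = 1`** (`GaloisRep.artinConductorExponent`, the
exponent entering `ModPGaloisRep.serreLevel`) at an additive `v ∤ 3` with `3 ∣ c_v`, granted
tameness of `E[3]` at ONE prime `𝔓 ∣ v`: the exponent is `⌊a_{𝔓₀}⌋₊` at a chosen `𝔓₀ ∣ v`,
`a_{𝔓₀} = a_𝔓` (`GaloisRep.artinConductorAt_eq_of_mem_primesAbove_holds`) `= 1`.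
[cite: SerreLocalFields1979, Ch. VI §3 (the exponent f(χ, 𝔭))] [cite: Serre1987, §1.2 (definition of N(ρ))] -/
theorem artinConductorExponent_torsion_three_eq_one_of_isTameAt [W.IsElliptic]
    (hadd : W.HasAdditiveReductionAt v) (h3v : (3 : 𝓞 K) ∉ v.asIdeal)
    (hdvd : 3 ∣ (W.baseChange (v.adicCompletion K)).localTamagawaNumber
      (v.adicCompletionIntegers K))
    {𝔓 : Ideal (absIntegers (𝓞 K) K)} (h𝔓 : 𝔓 ∈ v.primesAbove)
    (htame : (W.torsionGaloisRep 3).IsTameAt (𝓞 K) 𝔓) :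
    (W.torsionGaloisRep 3).artinConductorExponent v = 1 := by
  have h0 := (primesAbove_nonempty v).some_mem
  unfold GaloisRep.artinConductorExponent
  rw [GaloisRep.artinConductorAt_eq_of_mem_primesAbove_holds h0 h𝔓 (W.torsionGaloisRep 3),
    W.artinConductorAt_torsion_three_eq_one_of_isTameAt hadd h3v hdvd h𝔓 htame, Nat.floor_one]

/-- **The conductor drop at a shadow prime, unconditionally: `a_v(E[3]) = 1` at every additive place
`v ∤ 6` with `3 ∣ c_v`.**  For an elliptic curve `E/K` over a number field and a finite place `v` with
`2, 3 ∉ v`, additive reduction and `3 ∣ c_v = [E(K_v) : E₀(K_v)]` (Kodaira type `IV` or `IV*` with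
rational component group of order `3`), the Serre conductor exponent of the `3`-torsion
representation `E[3]` at `v` is `1` — whereas the conductor exponent of `E` at `v` is `f_v = 2`
(`conductorExponent_eq_tameConductorExponent_holds`).  Over `ℚ` this is `q ∥ N(ρ̄_{E,3})` at every
shadow prime `q ≥ 5` of line `shadow_seed` (crux `KobayashiLowerHalfLargeImage`): the clause that makes
the level-lowered newform Steinberg at `q`.  Tameness from
`isTameAt_torsionGaloisRep_of_notMem_two_three`.
[cite: SerreLocalFields1979, Ch. VI §§2–3] [cite: Serre1987, §1.2 (definition of N(ρ))]
[cite: SilvermanATAEC1994, Thm. IV.10.2(b) (PDF pp. 358–362) and Table 4.1 (p. 365)] -/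
theorem artinConductorExponent_torsion_three_eq_one [W.IsElliptic]
    (hadd : W.HasAdditiveReductionAt v) (h2 : (2 : 𝓞 K) ∉ v.asIdeal) (h3 : (3 : 𝓞 K) ∉ v.asIdeal)
    (hdvd : 3 ∣ (W.baseChange (v.adicCompletion K)).localTamagawaNumber
      (v.adicCompletionIntegers K)) :
    (W.torsionGaloisRep 3).artinConductorExponent v = 1 := by
  haveI : Fact (Nat.Prime 3) := ⟨Nat.prime_three⟩
  obtain ⟨𝔓, h𝔓⟩ := primesAbove_nonempty v
  exact W.artinConductorExponent_torsion_three_eq_one_of_isTameAt hadd h3 hdvd h𝔓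
    (W.isTameAt_torsionGaloisRep_of_notMem_two_three 3 (by exact_mod_cast h3) h2 h3 h𝔓)

/-- **The conductor DROP, displayed: `a_v(E[3]) + 1 = f_v(E)`** at an additive `v ∤ 6` with
`3 ∣ c_v` (`a_v(E[3]) = 1`, `artinConductorExponent_torsion_three_eq_one`; `f_v(E) = ε_v = 2`,
`conductorExponent_eq_tameConductorExponent_holds` with `KodairaSymbol.tameConductorExponent_eq_two_iff`
and `isAdditive_kodairaSymbolAt_iff_holds`).
[cite: SilvermanATAEC1994, Thm. IV.10.2 and IV.10.4 (PDF pp. 358–362)] [cite: Serre1987, §1.2 (definition of N(ρ))] -/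
theorem artinConductorExponent_torsion_three_add_one_eq_conductorExponent [W.IsElliptic]
    (hadd : W.HasAdditiveReductionAt v) (h2 : (2 : 𝓞 K) ∉ v.asIdeal) (h3 : (3 : 𝓞 K) ∉ v.asIdeal)
    (hdvd : 3 ∣ (W.baseChange (v.adicCompletion K)).localTamagawaNumber
      (v.adicCompletionIntegers K)) :
    (W.torsionGaloisRep 3).artinConductorExponent v + 1 = W.conductorExponent v := by
  haveI : PerfectField (IsLocalRing.ResidueField (v.adicCompletionIntegers K)) :=
    PerfectField.ofFinite
  rw [W.artinConductorExponent_torsion_three_eq_one hadd h2 h3 hdvd,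
    conductorExponent_eq_tameConductorExponent_holds v W
      (v.ringChar_ne_of_natCast_notMem (p := 2) (by exact_mod_cast h2))
      (v.ringChar_ne_of_natCast_notMem (p := 3) (by exact_mod_cast h3)),
    (KodairaSymbol.tameConductorExponent_eq_two_iff _).mpr
      ((isAdditive_kodairaSymbolAt_iff_holds v W).mpr hadd)]

end Three

/-! ## §5. `p ≥ 5`: `E[p]^{I_v} = 0` at additive `v ∤ p`, and `a_v(E[p]) = 2 = f_v(E)` at `v ∤ 6p` -/

section FiveLe

variable {v : HeightOneSpectrum (𝓞 K)}

/-- **For `p ≥ 5`, an inertia-fixed subgroup of `E[p]` at an additive `v ∤ p` is trivial.**  A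
subgroup `A ≤ E[p]` fixed pointwise by the local inertia group `absInertia K_v` (through
`absGaloisRestrict`) has `#A ≤ 4` (`natCard_le_four_of_absInertia_fixed_of_hasAdditiveReductionAt`:
it injects into `E(K_v^nr)/E₀(K_v^nr)`, of order `≤ 4` at an additive place) and `#A ∣ #E[p] = p²`,
so `#A = 1` once `p ≥ 5`.  ("At an additive prime `q ∤ p`, `p ≥ 5`, inertia acts on `E[p]` without
fixed points.")
[cite: SilvermanAEC2009, Thm. VII.6.1 with Cor. VII.6.2 (PDF p. 177), Cor. III.6.4(b)]
[cite: SilvermanATAEC1994, Cor. IV.9.2(d) (PDF p. 340)] -/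
theorem eq_bot_of_absInertia_fixed_of_hasAdditiveReductionAt_of_five_le [W.IsElliptic]
    (hadd : W.HasAdditiveReductionAt v) {p : ℕ} (hp : p.Prime) (h5 : 5 ≤ p)
    (hpv : (p : 𝓞 K) ∉ v.asIdeal) (A : AddSubgroup (geomPoints W))
    (hAp : A ≤ geomTorsion W (p : ℤ))
    (hAI : ∀ σ ∈ absInertia (v.adicCompletion K), ∀ P ∈ A,
      absGaloisRestrict K (v.adicCompletion K) σ • P = P) :
    A = ⊥ := by
  have hle4 : Nat.card A ≤ 4 :=
    W.natCard_le_four_of_absInertia_fixed_of_hasAdditiveReductionAt hadd hpv A hAp hAI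
  have hsq : Nat.card (geomTorsion W ((p : ℕ) : ℤ)) = p ^ 2 :=
    card_torsionBy_eq_sq (E := W.baseChange (AlgebraicClosure K)) (n := p)
      (by exact_mod_cast hp.ne_zero)
  have hdvd : Nat.card A ∣ p ^ 2 := hsq ▸ AddSubgroup.card_dvd_of_le hAp
  obtain ⟨k, hk, hkA⟩ := (Nat.dvd_prime_pow hp).mp hdvd
  rcases k with _ | k
  · exact AddSubgroup.eq_bot_of_card_eq A (by rw [hkA, pow_zero])
  · exfalso
    have hpk : p ≤ p ^ (k + 1) := by
      calc p = p ^ 1 := (pow_one p).symm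
        _ ≤ p ^ (k + 1) := Nat.pow_le_pow_right hp.pos (Nat.le_add_left 1 k)
    rw [hkA] at hle4
    omega

/-- **`E[p]^{I_𝔓} = 0` for `p ≥ 5` at an additive `v ∤ p`** (`𝔓 = 𝔓_{ι₀,𝔐}`): the global inertia
invariants are the local ones (`mem_fixedSubmodule_inertia_primeBelow_iff`, `inertia_eq_absInertia`),
and those form a trivial subgroup (`eq_bot_of_absInertia_fixed_of_hasAdditiveReductionAt_of_five_le`).
[cite: SilvermanAEC2009, Thm. VII.6.1 with Cor. VII.6.2 (PDF p. 177)]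
[cite: SilvermanATAEC1994, Cor. IV.9.2(d) (PDF p. 340)] -/
theorem fixedSubmodule_inertia_primeBelow_torsion_eq_bot_of_five_le [W.IsElliptic]
    (hadd : W.HasAdditiveReductionAt v) {p : ℕ} (hp : p.Prime) (h5 : 5 ≤ p)
    (hpv : (p : 𝓞 K) ∉ v.asIdeal)
    {𝔐 : Ideal (localAbsIntegers v)} (h𝔐 : 𝔐 ∈ v.localPrimesAbove) :
    (W.torsionGaloisRep p).fixedSubmodule
        ((v.primeBelow (closureEmb (K := K) (v.adicCompletion K)) 𝔐).inertia
          (absoluteGaloisGroup K)) = ⊥ := by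
  obtain ⟨w, hw⟩ := v.exists_spectralValuation
  have hIeq : 𝔐.inertia (absoluteGaloisGroup (v.adicCompletion K)) =
      absInertia (v.adicCompletion K) := inertia_eq_absInertia hw h𝔐
  -- the subgroup of ALL `p`-torsion points fixed by the local inertia group is trivial
  set A : AddSubgroup (geomPoints W) :=
    { carrier := {P | P ∈ geomTorsion W (p : ℤ) ∧ ∀ σ ∈ absInertia (v.adicCompletion K),
        absGaloisRestrict K (v.adicCompletion K) σ • P = P}
      add_mem' := fun {a b} ha hb ↦ ⟨(geomTorsion W (p : ℤ)).add_mem ha.1 hb.1,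
        fun σ hσ ↦ by rw [smul_add, ha.2 σ hσ, hb.2 σ hσ]⟩
      zero_mem' := ⟨(geomTorsion W (p : ℤ)).zero_mem, fun σ _ ↦ smul_zero _⟩
      neg_mem' := fun {a} ha ↦ ⟨(geomTorsion W (p : ℤ)).neg_mem ha.1,
        fun σ hσ ↦ by rw [smul_neg, ha.2 σ hσ]⟩ } with hAdef
  have hmemA : ∀ P, P ∈ A ↔ P ∈ geomTorsion W (p : ℤ) ∧ ∀ σ ∈ absInertia (v.adicCompletion K),
      absGaloisRestrict K (v.adicCompletion K) σ • P = P := fun _ ↦ Iff.rfl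
  have hAbot : A = ⊥ :=
    W.eq_bot_of_absInertia_fixed_of_hasAdditiveReductionAt_of_five_le hadd hp h5 hpv A
      (fun P hP ↦ hP.1) (fun σ hσ P hP ↦ hP.2 σ hσ)
  rw [eq_bot_iff]
  intro P hP
  rw [Submodule.mem_bot]
  have hPA : (P : geomPoints W) ∈ A := by
    rw [hmemA]
    refine ⟨P.2, fun σ hσ ↦ ?_⟩
    rw [← hIeq] at hσ
    exact (W.mem_fixedSubmodule_inertia_primeBelow_iff h𝔐 P).mp hP σ hσ
  rw [hAbot, AddSubgroup.mem_bot] at hPA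
  exact Subtype.ext hPA

/-- **`codim E[p]^{I_𝔓} = 2` for `p ≥ 5` at EVERY prime `𝔓 ∣ v` of an additive `v ∤ p`**:
`dim E[p] = 2` (`finrank_geomTorsion_eq_two`), `E[p]^{I_𝔓} = 0` at `𝔓_{ι₀,𝔐}`
(`fixedSubmodule_inertia_primeBelow_torsion_eq_bot_of_five_le`) and at the conjugate primes
(`ContinuousRep.fixedSubmodule_conj_smul`, `Ideal.inertia_smul`,
`exists_smul_eq_of_mem_primesAbove_holds`).  This is Silverman's `ε_v = 2` read on the `p`-torsion.
[cite: SilvermanATAEC1994, §IV.10, Definition of ε and Thm. IV.10.2 (PDF p. 358)]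
[cite: SerreLocalFields1979, Ch. VI §2 Cor. 1' and §3 (globalisation)] -/
theorem codimFixed_inertia_torsion_eq_two_of_five_le [W.IsElliptic]
    (hadd : W.HasAdditiveReductionAt v) {p : ℕ} [Fact p.Prime] (h5 : 5 ≤ p)
    (hpv : (p : 𝓞 K) ∉ v.asIdeal)
    {𝔓 : Ideal (absIntegers (𝓞 K) K)} (h𝔓 : 𝔓 ∈ v.primesAbove) :
    (W.torsionGaloisRep p).codimFixed (𝔓.inertia (absoluteGaloisGroup K)) = 2 := by
  have hp : p.Prime := Fact.out
  obtain ⟨𝔐, h𝔐⟩ := v.localPrimesAbove_nonempty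
  have h𝔓₁ : v.primeBelow (closureEmb (K := K) (v.adicCompletion K)) 𝔐 ∈ v.primesAbove :=
    primeBelow_mem_primesAbove h𝔐
  obtain ⟨g, hg⟩ := HeightOneSpectrum.exists_smul_eq_of_mem_primesAbove_holds h𝔓₁ h𝔓
  rw [← hg, Ideal.inertia_smul, ContinuousRep.codimFixed_conj_smul]
  haveI : Finite (geomTorsion W ((p : ℕ) : ℤ)) := W.finite_geomTorsion_nat hp.ne_zero
  haveI : Module.Finite (ZMod p) (geomTorsion W ((p : ℕ) : ℤ)) := Module.Finite.of_finite
  have h2 : Module.finrank (ZMod p) (geomTorsion W ((p : ℕ) : ℤ)) = 2 :=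
    W.finrank_geomTorsion_eq_two p (by exact_mod_cast hp.ne_zero)
  have h0 := W.fixedSubmodule_inertia_primeBelow_torsion_eq_bot_of_five_le hadd hp h5 hpv h𝔐
  have h := ContinuousRep.codimFixed_eq_finrank_sub (W.torsionGaloisRep p)
    ((v.primeBelow (closureEmb (K := K) (v.adicCompletion K)) 𝔐).inertia (absoluteGaloisGroup K))
  rw [h2] at h
  rw [h]
  change 2 - Module.finrank (ZMod p) ((W.torsionGaloisRep p).fixedSubmodule _) = 2
  rw [h0, finrank_bot, Nat.sub_zero]

/-- **`a_𝔓(E[p]) = 2` for `p ≥ 5` at an additive `v ∤ p`, granted tameness of `E[p]` at `𝔓`**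
(`a_𝔓 = codim + Sw = 2 + 0`; `codimFixed_inertia_torsion_eq_two_of_five_le`,
`GaloisRep.IsTameAt.swanConductorAt_eq_zero`).
[cite: SerreLocalFields1979, Ch. VI §2, Cor. 1'] [cite: Serre1987, §1.2 (definition of N(ρ))] -/
theorem artinConductorAt_torsion_eq_two_of_isTameAt_of_five_le [W.IsElliptic]
    (hadd : W.HasAdditiveReductionAt v) {p : ℕ} [Fact p.Prime] (h5 : 5 ≤ p)
    (hpv : (p : 𝓞 K) ∉ v.asIdeal)
    {𝔓 : Ideal (absIntegers (𝓞 K) K)} (h𝔓 : 𝔓 ∈ v.primesAbove)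
    (htame : (W.torsionGaloisRep p).IsTameAt (𝓞 K) 𝔓) :
    (W.torsionGaloisRep p).artinConductorAt (𝓞 K) 𝔓 = 2 := by
  rw [GaloisRep.artinConductorAt_def, htame.swanConductorAt_eq_zero, add_zero,
    W.codimFixed_inertia_torsion_eq_two_of_five_le hadd h5 hpv h𝔓, Nat.cast_ofNat]

/-- **`a_v(E[p]) = 2` for `p ≥ 5` at every additive place `v ∤ 6p`** (unconditional: tameness from
`isTameAt_torsionGaloisRep_of_notMem_two_three`; the exponent `⌊a_{𝔓₀}⌋₊` is independent of the prime,
`GaloisRep.artinConductorAt_eq_of_mem_primesAbove_holds`).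
[cite: SerreLocalFields1979, Ch. VI §§2–3] [cite: Serre1987, §1.2 (definition of N(ρ))]
[cite: SilvermanATAEC1994, Thm. IV.10.2(b) (PDF pp. 358–362)] -/
theorem artinConductorExponent_torsion_eq_two_of_five_le [W.IsElliptic]
    (hadd : W.HasAdditiveReductionAt v) {p : ℕ} [Fact p.Prime] (h5 : 5 ≤ p)
    (hpv : (p : 𝓞 K) ∉ v.asIdeal) (h2 : (2 : 𝓞 K) ∉ v.asIdeal) (h3 : (3 : 𝓞 K) ∉ v.asIdeal) :
    (W.torsionGaloisRep p).artinConductorExponent v = 2 := by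
  obtain ⟨𝔓, h𝔓⟩ := primesAbove_nonempty v
  have h0 := (primesAbove_nonempty v).some_mem
  have htame := W.isTameAt_torsionGaloisRep_of_notMem_two_three p hpv h2 h3 h𝔓
  unfold GaloisRep.artinConductorExponent
  rw [GaloisRep.artinConductorAt_eq_of_mem_primesAbove_holds h0 h𝔓 (W.torsionGaloisRep p),
    W.artinConductorAt_torsion_eq_two_of_isTameAt_of_five_le hadd h5 hpv h𝔓 htame]
  exact Nat.floor_ofNat 2

/-- **No conductor drop for `p ≥ 5`: `a_v(E[p]) = f_v(E)` at every additive place `v ∤ 6p`.**  For an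
elliptic curve `E/K` over a number field, a prime `p ≥ 5` and a finite place `v` of additive reduction
with `2, 3, p ∉ v`: the Serre conductor exponent of `E[p]` at `v` equals the conductor exponent
`f_v(E) = 2` of `E` (`artinConductorExponent_torsion_eq_two_of_five_le`;
`conductorExponent_eq_tameConductorExponent_holds`, `KodairaSymbol.tameConductorExponent_eq_two_iff`,
`isAdditive_kodairaSymbolAt_iff_holds`).  So the prime-to-`p` Serre level of `ρ̄_{E,p}` keeps every
additive prime `q ∤ 6p` of `E` with its full exponent `2`: for `p ≥ 5` no member of the mod-`p`
congruence class of `E` is semistable at such a `q` (the dossier's "level transport is dead at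
`p ≥ 5`").
[cite: SilvermanATAEC1994, Thm. IV.10.2 and IV.10.4 (PDF pp. 358–362)] [cite: Serre1987, §1.2 (definition of N(ρ)) and §4.1]
[cite: Carayol1989, Introduction] -/
theorem artinConductorExponent_torsion_eq_conductorExponent_of_five_le [W.IsElliptic]
    (hadd : W.HasAdditiveReductionAt v) {p : ℕ} [Fact p.Prime] (h5 : 5 ≤ p)
    (hpv : (p : 𝓞 K) ∉ v.asIdeal) (h2 : (2 : 𝓞 K) ∉ v.asIdeal) (h3 : (3 : 𝓞 K) ∉ v.asIdeal) :
    (W.torsionGaloisRep p).artinConductorExponent v = W.conductorExponent v := by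
  haveI : PerfectField (IsLocalRing.ResidueField (v.adicCompletionIntegers K)) :=
    PerfectField.ofFinite
  rw [W.artinConductorExponent_torsion_eq_two_of_five_le hadd h5 hpv h2 h3,
    conductorExponent_eq_tameConductorExponent_holds v W
      (v.ringChar_ne_of_natCast_notMem (p := 2) (by exact_mod_cast h2))
      (v.ringChar_ne_of_natCast_notMem (p := 3) (by exact_mod_cast h3)),
    (KodairaSymbol.tameConductorExponent_eq_two_iff _).mpr
      ((isAdditive_kodairaSymbolAt_iff_holds v W).mpr hadd)]

end FiveLe

end WeierstrassCurve

end
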